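import Mathlib
import HarnessLib
import Literature.NumberTheory.Automorphic.BaseChangeArchimedeanOfExists
import Literature.NumberTheory.Automorphic.StrongMultiplicityOneRepDataAE
import Literature.NumberTheory.Automorphic.AutomorphicRepInfinitesimalCharacter
import Literature.NumberTheory.Automorphic.AdelicGroupDataAutomorphicMeasureProofs
import Literature.NumberTheory.Automorphic.JacquetLanglandsParts

/-!
# Stub `stub_archimedean_of_exists` of line Sketch (crux stmt-Langlands-16812
`ParityBlindBianchi.QuadraticBaseChangeGL2`) — clause (d) for EVERY cuspidal weak lift

Helper file (`--supports stmt-Langlands-16812`) of the quadratic base change theorem for `GL₂`.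
Clause (d) of the crux says: for `E/F` Galois quadratic, `π` cuspidal on `GL₂(𝔸_F)` and EVERY
cuspidal weak base-change lift `P` of `π` to `GL₂(𝔸_E)` (Arthur–Clozel 1989, Ch. 3, Def. 1.1, the
a.e. Satake relation `IsWeakBaseChangeLiftAE`), every archimedean (Harish-Chandra) parameter `χ`
of `π` restricts to the archimedean parameter `τ ↦ χ(τ|_F)` of `P` (Thm. 5.1 with Ch. 1 §7).

* `stub_archimedean_of_exists` — the registered stub: this universal clause from (`hex`) its
  EXISTENCE form at `n = 2` (one good cuspidal lift `P₀` carrying the Hecke relation at every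
  finite place, descent of unramifiedness, and the restricted archimedean parameter) together with
  (`hsmo`) strong multiplicity one at the spherical levels on `GL₂` over every number field
  (Jacquet–Shalika 1981, Thm. 4.4).  It is the `n = 2` copy of
  `ArthurClozel1989_strongLifting_archimedean.of_exists` in its `hL2`-free form: `P` and `P₀` are
  nearly equivalent (`IsWeakBaseChangeLiftAE.isNearlyEquivalent`), `P` has SOME archimedean
  parameter `χ_P` (`AutomorphicRepData.exists_hasArchParameter_gl`, Schur), and
  `CuspidalAutomorphicRepData.hasArchParameter_eq_of_isNearlyEquivalent_of_smo` (for the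
  automorphic measure of `AdelicGroupData.exists_isAutomorphicMeasure_gl_holds`) identifies
  `χ_P = χ ∘ (·|_F)`.

No definitions, no named facts.
-/

noncomputable section

open scoped BigOperators Topology Classical Matrix NumberField MatrixGroups
open Literature.NumberTheory.Automorphic IsDedekindDomain NumberField Filter MeasureTheory
open Literature.NumberTheory.Automorphic.AdelicGroupData

-- `Summit.Langlands.Langlands.…`: summit = sub-problem name (D-0017 nested layout), not a typo.
set_option linter.dupNamespace false

namespace Summit.Langlands.Langlands.Theorems.QuadraticBaseChangeGL2

/-! ### The stub -/

-- adapted from Literature/NumberTheory/Automorphic/BaseChangeArchimedeanOfExists.lean (of_exists)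
/-- **Stub `stub_archimedean_of_exists` (clause (d) for EVERY cuspidal weak lift `P` of `π`).**
Let `E/F` be a Galois quadratic extension of number fields and `π` a cuspidal Borel–Jacquet datum
on `GL₂(𝔸_F)`.  Assume (`hex`) the strong lift in EXISTENCE form: whenever `π` has some cuspidal
weak base-change lift to `E`, it has one, `P₀`, with (i) `t_{P₀,w} = t_{π,v}^{f(w|v)}` at every
finite `w ∣ v` with `π_v` unramified, (ii) descent of unramifiedness over the places unramified in
`E`, (iii) archimedean parameter `τ ↦ χ_π(τ|_F)`; and (`hsmo`) strong multiplicity one at the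
spherical levels on `GL₂` over every number field.  Then EVERY cuspidal weak lift `P` of `π` has
archimedean parameter `τ ↦ χ(τ|_F)` for every archimedean parameter `χ` of `π`.  Proof (the
`n = 2` copy of `ArthurClozel1989_strongLifting_archimedean.of_exists`, `hL2`-free): the good lift
`P₀` of `hex` is in particular a weak lift (`Filter.Eventually.of_forall` on clause (i)), so `P`
and `P₀` are nearly equivalent (`IsWeakBaseChangeLiftAE.isNearlyEquivalent`, Flath for `π`); `P`
has some archimedean parameter `χ_P` (`AutomorphicRepData.exists_hasArchParameter_gl`, Schur's
lemma); and rigidity (`CuspidalAutomorphicRepData.hasArchParameter_eq_of_isNearlyEquivalent_of_smo`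
from `hsmo E`, for the automorphic measure of `AdelicGroupData.exists_isAutomorphicMeasure_gl_holds`)
gives `χ_P = χ ∘ (·|_F)`. [cite: ArthurClozelAMS120, Ch. 3 Thm. 5.1 and Ch. 1 §7] -/
theorem stub_archimedean_of_exists
    (hex : ∀ (F E : Type) [Field F] [NumberField F] [Field E] [NumberField E] [Algebra F E] [IsGalois F E], Module.finrank F E = 2 → ∀ (hF : Literature.NumberTheory.Automorphic.isCompact_glFiniteIntegralLevel 2 F) (hE : Literature.NumberTheory.Automorphic.isCompact_glFiniteIntegralLevel 2 E) (π : Literature.NumberTheory.Automorphic.CuspidalAutomorphicRepData 2 F hF), (∃ P : Literature.NumberTheory.Automorphic.CuspidalAutomorphicRepData 2 E hE, Literature.NumberTheory.Automorphic.IsWeakBaseChangeLiftAE π.1 P.1) → ∃ P₀ : Literature.NumberTheory.Automorphic.CuspidalAutomorphicRepData 2 E hE, (∀ (w : IsDedekindDomain.HeightOneSpectrum (NumberField.RingOfIntegers E)) (v : IsDedekindDomain.HeightOneSpectrum (NumberField.RingOfIntegers F)) (α : Multiset ℂ), w.asIdeal.under (NumberField.RingOfIntegers F) = v.asIdeal →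 π.1.HasSatakeParamAt v α → P₀.1.HasSatakeParamAt w (α.map (· ^ w.asIdeal.inertiaDeg (NumberField.RingOfIntegers F)))) ∧ (∀ v : IsDedekindDomain.HeightOneSpectrum (NumberField.RingOfIntegers F), Algebra.IsUnramifiedIn (NumberField.RingOfIntegers E) v.asIdeal → (∀ w : IsDedekindDomain.HeightOneSpectrum (NumberField.RingOfIntegers E), w.asIdeal.under (NumberField.RingOfIntegers F) = v.asIdeal → P₀.1.IsUnramifiedAt w) → π.1.IsUnramifiedAt v) ∧ (∀ χ : (F →+* ℂ) → Multiset ℂ, π.1.HasArchParameter χ → P₀.1.HasArchParameter fun τ => χ (τ.comp (algebraMap F E))))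
    (hsmo : ∀ (K : Type) [Field K] [NumberField K], strong_multiplicity_one_gl_sphericalLevel 2 K) :
    ∀ (F E : Type) [Field F] [NumberField F] [Field E] [NumberField E] [Algebra F E] [IsGalois F E], Module.finrank F E = 2 → ∀ (hF : Literature.NumberTheory.Automorphic.isCompact_glFiniteIntegralLevel 2 F) (hE : Literature.NumberTheory.Automorphic.isCompact_glFiniteIntegralLevel 2 E) (π : Literature.NumberTheory.Automorphic.CuspidalAutomorphicRepData 2 F hF) (P : Literature.NumberTheory.Automorphic.CuspidalAutomorphicRepData 2 E hE), Literature.NumberTheory.Automorphic.IsWeakBaseChangeLiftAE π.1 P.1 → ∀ χ : (F →+* ℂ) → Multiset ℂ, π.1.HasArchParameter χ → P.1.HasArchParameter fun τ => χ (τ.comp (algebraMap F E)) := by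
  intro F E _ _ _ _ _ _ h2 hF hE π P hBC χ hχ
  -- the good lift `P₀` of the existence form
  obtain ⟨P₀, hrel, -, harch⟩ := hex F E h2 hF hE π ⟨P, hBC⟩
  -- `P₀` is in particular a weak lift (the relation holds at EVERY finite place)
  have hBC₀ : IsWeakBaseChangeLiftAE π.1 P₀.1 :=
    Filter.Eventually.of_forall fun w v α h hα => hrel w v α h hα
  -- `P` has some archimedean parameter (Schur)
  obtain ⟨χP, hχP⟩ := P.1.exists_hasArchParameter_gl
  -- an automorphic measure on `GL₂(F) A_G \ GL₂(𝔸_E)` (Borel–Harish-Chandra)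
  obtain ⟨μm, hμm⟩ := AdelicGroupData.exists_isAutomorphicMeasure_gl_holds 2 E
  haveI := hμm
  -- rigidity: nearly equivalent cuspidal data have the same archimedean parameter
  have e : χP = fun τ => χ (τ.comp (algebraMap F E)) :=
    CuspidalAutomorphicRepData.hasArchParameter_eq_of_isNearlyEquivalent_of_smo (μm := μm) (hsmo E) P P₀
      (hBC.isNearlyEquivalent hBC₀) hχP (harch χ hχ)
  exact e ▸ hχP

end Summit.Langlands.Langlands.Theorems.QuadraticBaseChangeGL2

end
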